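import Literature.MathematicalPhysics.QuantumFieldTheory.Balaban1983to89.B7Eq78Linearization
import Mathlib.Analysis.Calculus.FDeriv.Analytic
import Mathlib.Analysis.Calculus.ContDiff.Basic
import Mathlib.Analysis.Calculus.IteratedDeriv.Defs
import Mathlib.Analysis.Calculus.Deriv.Mul
import Mathlib.Analysis.SpecialFunctions.Exponential

/-!
# T⁴ programme, spine estimate NE1′ (node O3b/H2) — THE NON-ABELIAN GERM OF THE CURVATURE CHANNEL: the second
# derivative of Bałaban's `log` (21) along a product of two one-parameter groups is the COMMUTATOR,
# `d²/dt²|₀ log(e^{tX} e^{tY}) = XY − YX` (Baker–Campbell–Hausdorff to second order), in any complete normed ℂ-algebra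

Cell `pub-balaban-gaps` (YM blitz Y1, track G2), seat `ne1` gen 9 (prover-pub-balaban-gaps-ne1-g9-0); record `HOME/ne/NE1.md` v9
§4 R56 (door (d) of the gen-7∕gen-8 handoffs: «the cross-term formula `iteratedDeriv 2 (t ↦ log Ū_c(e^{tA})) 0 = Σ commutators` for
general `A`» — this file is its two-factor GERM).  ADDITIVE — imports the r04 lineage's `B7Eq78Linearization` (its
`hasFDerivAt_mlog_one`: `D log(1) = id`; through it `MatrixLog.mlog` = (21) and `Literature.Analysis.Complex.logOnePlus` with its
power series `hasFPowerSeriesOnBall_logOnePlus`) and Mathlib ONLY; nothing edited or restated; 0 def.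

PRINT.  [Balaban1985Averaging] = T. Bałaban, *Averaging operations for lattice gauge theories*, CMP **98** (1985) 17–51: (21) p. 21
`log X = Σ_{n≥1} ((−1)^{n+1}/n)(X − 1)^n`, «both functions are analytic functions of complex matrices X»; (15) p. 19 (the block
average is `exp` of an average of `log`'s of products of bond variables `U(Γ_{c,x})U(c)⁻¹`); p. 20 «taking `U = e^{iA}` with `A`
small and expanding the logarithm … in powers of `A`, we get the expression (14) as a linear term in the expansion».  Gen 8
(`B7AveragingAbelianSector`) proved the expansion has NO second-order term along COMMUTING directions; this file computes the
second-order term for the simplest non-commuting word, two factors: it is the commutator ([folklore] BCH,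
`log(e^{tX}e^{tY}) = t(X+Y) + (t²/2)[X,Y] + O(t³)`).

WHAT THIS FILE PROVES ([folklore]; 0 sorry).  In a complete normed ℂ-algebra `𝔸`:
* `fderiv_fderiv_mlog_one_apply_self` — the second Fréchet derivative of (21) at `1` on the diagonal: `D²log(1)(h, h) = −h²`
  (power series (21): coefficient `−½`, times `2!`);
* `hasDerivAt_expProd` ∕ `hasDerivAt_expProd_deriv_zero` — the curve `γ(t) = e^{tX}e^{tY}`: `γ′(t) = Xe^{tX}e^{tY} + e^{tX}Ye^{tY}`,
  `γ″(0) = X² + 2XY + Y²` (written `X·X + X·Y + X·Y + Y·Y`);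
* `deriv_mlog_expProd_zero` — `d/dt|₀ log(e^{tX}e^{tY}) = X + Y` (the linear term, p. 20);
* `iteratedDeriv_two_mlog_comp` — the REUSABLE second-order chain rule through (21) at `1`: for any curve with `γ(0) = 1`,
  derivative `γ₁` near `0` and `γ₁′(0) = w`, `d²/dt²|₀ log γ = w − γ₁(0)²` (the core of every «second derivative of log of a
  product of bond variables» computation; the many-bond word of (15) only adds list-product bookkeeping for `γ₁(0)`, `w`);
* **`iteratedDeriv_two_mlog_expProd_zero` — `d²/dt²|₀ log(e^{tX}e^{tY}) = XY − YX`** (`w = X² + 2XY + Y²`, `γ₁(0) = X + Y`);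
* `iteratedDeriv_two_mlog_exp_smul_zero` — a one-parameter group has no `log`-curvature, `d²/dt²|₀ log e^{tX} = 0`;
* **`iteratedDeriv_two_mlog_mul` — the COMPOSITION LAW `d²/dt²|₀ log(αβ) = d²/dt²|₀ log α + d²/dt²|₀ log β + [α′(0), β′(0)]`**
  for curves through `1`;
* **`iteratedDeriv_two_mlog_expProdList_zero` — WORDS OF ANY LENGTH: `d²/dt²|₀ log(e^{tA₀}⋯e^{tA_{n−1}}) = Σ_{i<j} [Aᵢ, Aⱼ]`**
  (the ordered product as a `List.ofFn`-product; induction on the length with the composition law; derivative data of the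
  product `exists_derivData_expProdList`); `iteratedDeriv_two_mlog_expList_zero` — the same for any `l : List 𝔸`;
* `derivData_mlog_comp` — the composable form of the second-order chain rule (derivative data of `log ∘ γ`: derivative near
  `0`, its derivative `w − γ₁(0)²` at `0`, value `γ₁(0)` at `0`), so that SUMS ∕ AVERAGES of such logarithms (the exponent
  `P` of (15)) inherit derivative data termwise;
* `fderiv_fderiv_exp_zero_apply_self` — `D²exp(0)(h,h) = h²`; **`iteratedDeriv_two_mlog_exp_mul` — THE OUTER STEP OF (15):
  for `P(0) = 0` and a curve `β` through `1`, `d²/dt²|₀ log(e^{P(t)} β(t)) = P″(0) + d²/dt²|₀ log β + [P′(0), β′(0)]`** — the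
  SHAPE of (15)∕(42) (`Ū_c(U) = exp[P]·U(c)`, `P` = the averaged loop logarithms, `U(c)` = the transport along the straight
  `L`-bond, itself a word): every term a commutator once `P″(0)` and `log U(c)″(0)` are (they are, by §5);
  `iteratedDeriv_two_mlog_exp_mul_exp_smul` — the case `β = e^{tC}`: `P″(0) + [P′(0), C]`.
So the diagonal curvature of `log ∘ (product of one-parameter bond variables)` — the building block of (15) — is EXACTLY the
sum of the pairwise commutators of the exponents: zero iff they commute to this order (gen 8's abelian sector), and
«cross-bond curvature = commutators» (NE1.md R46 (a)) at the level of the printed `log`∕`exp`.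

HONEST FRAMING.  [folklore] calculus in an abstract complete normed ℂ-algebra; the lineage's word objects (`hol`, `gammaWord` — whose
values on `e^{tA}` ARE such ordered products, with `A_b` or `−A_b` per orientation) and the concrete average `P` of (15)∕(42) are
NOT instantiated here (door (d) proper: rewriting + bookkeeping over `iteratedDeriv_two_mlog_expProdList_zero` ∕ `…_mul` ∕
`iteratedDeriv_two_mlog_exp_mul_exp_smul`); nothing of Bałaban's asserted beyond the SHAPE of (21) as typed by the lineage;
NE1′ NOT proved; spine 0∕9; (B) 0∕13; binders 0∕6; one fixed finite T⁴ — NOT ℝ⁴, NOT infinite volume, NOT a mass gap, NOT Clay.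
-/

noncomputable section

open scoped Topology
open NormedSpace Filter

namespace Summit.QuantumFields.BalabanUV.T4Continuum.NE1p.B7AveragingCommutator

open Literature.MathematicalPhysics.QuantumFieldTheory.Balaban1983to89.MatrixLog (mlog mlog_def analyticAt_mlog)
open Literature.MathematicalPhysics.QuantumFieldTheory.Balaban1983to89.B7Eq78Linearization (hasFDerivAt_mlog_one
  hasDerivAt_mlog_comp)
open Literature.Analysis.Complex (logOnePlus logSeriesCoeff hasFPowerSeriesOnBall_logOnePlus)

variable {𝔸 : Type*} [NormedRing 𝔸] [NormedAlgebra ℂ 𝔸] [CompleteSpace 𝔸]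

/-! ## §1 The second derivative of (21) at `1` -/

/-- **`D² log(1)(h, h) = −h²`**: the second Fréchet derivative of Bałaban's `log` (21) at the identity, on the diagonal, is
minus the square — the `n = 2` term `−½(X − 1)²` of the series (21) times `2!` (Mathlib `HasFPowerSeriesOnBall.factorial_smul`
on the lineage's `hasFPowerSeriesOnBall_logOnePlus`, translated from `0` to `1`). [cite: Balaban1985Averaging, (21) p.21] -/
theorem fderiv_fderiv_mlog_one_apply_self (h : 𝔸) :
    fderiv ℂ (fderiv ℂ (mlog : 𝔸 → 𝔸)) 1 h h = -(h * h) := by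
  have e : (mlog : 𝔸 → 𝔸) = fun z => logOnePlus (z - 1) := by
    funext z; exact mlog_def z
  have h2 := (hasFPowerSeriesOnBall_logOnePlus (𝔄 := 𝔸)).factorial_smul h 2
  rw [← iteratedFDeriv_two_apply (mlog : 𝔸 → 𝔸) 1 (fun _ => h), e, iteratedFDeriv_comp_sub' 2 (1 : 𝔸)]
  dsimp only
  rw [sub_self, ← h2, FormalMultilinearSeries.ofScalars_apply_eq]
  have hc : logSeriesCoeff 2 = -(1 / 2 : ℂ) := by
    norm_num [Literature.Analysis.Complex.logSeriesCoeff]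
  rw [hc, Nat.factorial_two, two_nsmul, ← add_smul, pow_two]
  norm_num

/-! ## §2 The curve `γ(t) = e^{tX} e^{tY}` -/

/-- `γ′(t) = X e^{tX} e^{tY} + e^{tX} (Y e^{tY})` for `γ(t) = e^{tX}e^{tY}` (product rule, Mathlib `hasDerivAt_exp_smul_const'`).
[folklore] -/
theorem hasDerivAt_expProd (X Y : 𝔸) (t : ℂ) :
    HasDerivAt (fun u : ℂ => exp (u • X) * exp (u • Y))
      (X * exp (t • X) * exp (t • Y) + exp (t • X) * (Y * exp (t • Y))) t :=
  (hasDerivAt_exp_smul_const' X t).fun_mul (hasDerivAt_exp_smul_const' Y t)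

/-- `γ″(0) = X² + XY + XY + Y²`: the derivative at `0` of `t ↦ γ′(t)`. [folklore] -/
theorem hasDerivAt_expProd_deriv_zero (X Y : 𝔸) :
    HasDerivAt (fun t : ℂ => X * exp (t • X) * exp (t • Y) + exp (t • X) * (Y * exp (t • Y)))
      (X * X + X * Y + X * Y + Y * Y) 0 := by
  have h1 : HasDerivAt (fun t : ℂ => X * exp (t • X) * exp (t • Y)) (X * X + X * Y) 0 := by
    have := ((hasDerivAt_exp_smul_const' X (0 : ℂ)).const_mul X).fun_mul (hasDerivAt_exp_smul_const' Y (0 : ℂ))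
    simpa using this
  have h2 : HasDerivAt (fun t : ℂ => exp (t • X) * (Y * exp (t • Y))) (X * Y + Y * Y) 0 := by
    have := (hasDerivAt_exp_smul_const' X (0 : ℂ)).fun_mul ((hasDerivAt_exp_smul_const' Y (0 : ℂ)).const_mul Y)
    simpa using this
  simpa [add_assoc] using h1.fun_add h2

/-! ## §3 `log(e^{tX}e^{tY})`: linear term `X + Y`, quadratic term `[X, Y]` -/

/-- The LINEAR term (p. 20): `d/dt|₀ log(e^{tX}e^{tY}) = X + Y` (the lineage's chain rule `hasDerivAt_mlog_comp` through
`D log(1) = id`). [cite: Balaban1985Averaging, (21) p.21, p.20] -/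
theorem hasDerivAt_mlog_expProd_zero (X Y : 𝔸) :
    HasDerivAt (fun t : ℂ => mlog (exp (t • X) * exp (t • Y))) (X + Y) 0 := by
  have h := hasDerivAt_mlog_comp (γ := fun u : ℂ => exp (u • X) * exp (u • Y)) (s₀ := 0) (by simp)
    (hasDerivAt_expProd X Y 0)
  simpa using h

/-- `d/dt|₀ log(e^{tX}e^{tY}) = X + Y`, `deriv` form. [cite: Balaban1985Averaging, (21) p.21, p.20] -/
theorem deriv_mlog_expProd_zero (X Y : 𝔸) :
    deriv (fun t : ℂ => mlog (exp (t • X) * exp (t • Y))) 0 = X + Y :=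
  (hasDerivAt_mlog_expProd_zero X Y).deriv

/-- **DERIVATIVE DATA OF `log ∘ γ` AT THE IDENTITY** ([folklore]): if `γ(0) = 1`, `γ′ = γ₁` near `0` and `γ₁′(0) = w`, then
near `0` the derivative of `t ↦ log γ(t)` is `D log(γ t)(γ₁ t)` ((21) analytic on the unit ball), this derivative function has
derivative `w − γ₁(0)²` at `0` (`D²log(1)(v,v) + Dlog(1)(w)`), and its value at `0` is `γ₁(0)`.  The composable form of the
second-order chain rule (sums and averages of such `log`'s, as in (15), inherit derivative data termwise).
[cite: Balaban1985Averaging, (21) p.21] -/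
theorem derivData_mlog_comp {γ γ₁ : ℂ → 𝔸} {w : 𝔸} (h0 : γ 0 = 1)
    (hγ : ∀ᶠ t in 𝓝 (0 : ℂ), HasDerivAt γ (γ₁ t) t) (hγ₁ : HasDerivAt γ₁ w 0) :
    (∀ᶠ t in 𝓝 (0 : ℂ), HasDerivAt (fun u : ℂ => mlog (γ u)) (fderiv ℂ (mlog : 𝔸 → 𝔸) (γ t) (γ₁ t)) t)
      ∧ HasDerivAt (fun t : ℂ => fderiv ℂ (mlog : 𝔸 → 𝔸) (γ t) (γ₁ t)) (w - γ₁ 0 * γ₁ 0) 0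
      ∧ fderiv ℂ (mlog : 𝔸 → 𝔸) (γ 0) (γ₁ 0) = γ₁ 0 := by
  have hcont : ContinuousAt γ 0 := hγ.self_of_nhds.continuousAt
  have hball : ∀ᶠ t : ℂ in 𝓝 0, ‖γ t - 1‖ < 1 := by
    have hmem : Metric.ball (1 : 𝔸) 1 ∈ 𝓝 (γ 0) := by
      rw [h0]; exact Metric.ball_mem_nhds (1 : 𝔸) one_pos
    filter_upwards [hcont.eventually_mem hmem] with t ht
    simpa [dist_eq_norm] using Metric.mem_ball.1 ht
  refine ⟨?_, ?_, ?_⟩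
  · filter_upwards [hball, hγ] with t ht hγt
    have h := ((analyticAt_mlog ht).differentiableAt.hasFDerivAt).comp_hasDerivAt t (f := γ) hγt
    simpa [Function.comp_def] using h
  · have hC2 : ContDiffAt ℂ 2 (mlog : 𝔸 → 𝔸) 1 := (analyticAt_mlog (X := (1 : 𝔸)) (by simp)).contDiffAt
    have hD : HasFDerivAt (fderiv ℂ (mlog : 𝔸 → 𝔸)) (fderiv ℂ (fderiv ℂ (mlog : 𝔸 → 𝔸)) 1) (γ 0) := by
      rw [h0]
      exact ((hC2.fderiv_right (m := 1) (by norm_num)).differentiableAt (by norm_num)).hasFDerivAt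
    have hc : HasDerivAt (fun t : ℂ => fderiv ℂ (mlog : 𝔸 → 𝔸) (γ t))
        (fderiv ℂ (fderiv ℂ (mlog : 𝔸 → 𝔸)) 1 (γ₁ 0)) 0 := by
      have := hD.comp_hasDerivAt (0 : ℂ) hγ.self_of_nhds
      simpa [Function.comp_def] using this
    have hG := hc.clm_apply hγ₁
    rw [h0, fderiv_fderiv_mlog_one_apply_self, hasFDerivAt_mlog_one.fderiv, ContinuousLinearMap.id_apply] at hG
    have e : -(γ₁ 0 * γ₁ 0) + w = w - γ₁ 0 * γ₁ 0 := by abel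
    rw [e] at hG
    exact hG
  · rw [h0, hasFDerivAt_mlog_one.fderiv, ContinuousLinearMap.id_apply]

/-- **SECOND-ORDER CHAIN RULE THROUGH (21) AT THE IDENTITY** ([folklore]): if a curve `γ` has `γ(0) = 1`, derivative
`γ₁(t)` near `t = 0`, and `γ₁′(0) = w`, then `d²/dt²|₀ log γ(t) = w − γ₁(0)²` — i.e. `D²log(1)(γ′, γ′) + Dlog(1)(γ″)` with
`D²log(1)(h,h) = −h²` and `Dlog(1) = id`.  The reusable core of every «second derivative of `log` of a product of bond
variables» computation ((15): `γ` = a product of one-parameter groups). [cite: Balaban1985Averaging, (21) p.21] -/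
theorem iteratedDeriv_two_mlog_comp {γ γ₁ : ℂ → 𝔸} {w : 𝔸} (h0 : γ 0 = 1)
    (hγ : ∀ᶠ t in 𝓝 (0 : ℂ), HasDerivAt γ (γ₁ t) t) (hγ₁ : HasDerivAt γ₁ w 0) :
    iteratedDeriv 2 (fun t : ℂ => mlog (γ t)) 0 = w - γ₁ 0 * γ₁ 0 := by
  obtain ⟨hF, hG, -⟩ := derivData_mlog_comp h0 hγ hγ₁
  have hder : deriv (fun t : ℂ => mlog (γ t)) =ᶠ[𝓝 0] fun t => fderiv ℂ (mlog : 𝔸 → 𝔸) (γ t) (γ₁ t) := by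
    filter_upwards [hF] with t ht
    exact ht.deriv
  have e2 : iteratedDeriv 2 (fun t : ℂ => mlog (γ t)) = deriv (deriv fun t : ℂ => mlog (γ t)) := by
    rw [iteratedDeriv_eq_iterate]; rfl
  rw [e2, hder.deriv_eq, hG.deriv]

/-- **BCH TO SECOND ORDER — `d²/dt²|₀ log(e^{tX}e^{tY}) = XY − YX`**: the diagonal curvature of Bałaban's `log` (21) along the
product of two one-parameter groups is the COMMUTATOR of the exponents (`iteratedDeriv_two_mlog_comp` with
`γ″(0) = X² + 2XY + Y²`, `γ′(0) = X + Y`: `(X² + 2XY + Y²) − (X+Y)² = [X, Y]`).  Zero iff `X, Y` commute to this order — the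
two-bond germ of «cross-bond curvature = commutators» for the printed averaging (15). [cite: Balaban1985Averaging, (21) p.21, (15) p.19] -/
theorem iteratedDeriv_two_mlog_expProd_zero (X Y : 𝔸) :
    iteratedDeriv 2 (fun t : ℂ => mlog (exp (t • X) * exp (t • Y))) 0 = X * Y - Y * X := by
  rw [iteratedDeriv_two_mlog_comp (γ := fun t : ℂ => exp (t • X) * exp (t • Y))
    (γ₁ := fun t : ℂ => X * exp (t • X) * exp (t • Y) + exp (t • X) * (Y * exp (t • Y))) (by simp)
    (Filter.Eventually.of_forall fun t => hasDerivAt_expProd X Y t) (hasDerivAt_expProd_deriv_zero X Y)]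
  simp only [zero_smul, exp_zero, mul_one, one_mul]
  noncomm_ring

/-! ## §4 The composition law: `log`-curvature of a product = sum of the `log`-curvatures + the commutator of the velocities -/

/-- A ONE-PARAMETER GROUP HAS NO `log`-CURVATURE: `d²/dt²|₀ log(e^{tX}) = 0` (`γ₁(t) = Xe^{tX}`, `w = X²`, `w − X² = 0`) —
the bare form of gen 8's abelian-sector statement. [cite: Balaban1985Averaging, (21) p.21] -/
theorem iteratedDeriv_two_mlog_exp_smul_zero (X : 𝔸) :
    iteratedDeriv 2 (fun t : ℂ => mlog (exp (t • X))) 0 = 0 := by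
  have h1 : ∀ t : ℂ, HasDerivAt (fun u : ℂ => exp (u • X)) (X * exp (t • X)) t := fun t => hasDerivAt_exp_smul_const' X t
  have h2 : HasDerivAt (fun t : ℂ => X * exp (t • X)) (X * X) 0 := by
    simpa using (hasDerivAt_exp_smul_const' X (0 : ℂ)).const_mul X
  rw [iteratedDeriv_two_mlog_comp (γ := fun u : ℂ => exp (u • X)) (γ₁ := fun t : ℂ => X * exp (t • X)) (by simp)
    (Filter.Eventually.of_forall h1) h2]
  simp

/-- **COMPOSITION LAW** ([folklore]; the induction step behind «cross-bond curvature = commutators» for words of any length):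
for two curves `α, β` through `1` with derivatives `α₁, β₁` near `0` and `α₁′(0) = w_a`, `β₁′(0) = w_b`,
`d²/dt²|₀ log(αβ) = d²/dt²|₀ log α + d²/dt²|₀ log β + [α₁(0), β₁(0)]`.
With `iteratedDeriv_two_mlog_exp_smul_zero` this gives, by induction in the consumer's own vocabulary, `d²/dt²|₀ log ∏ᵢ e^{tAᵢ}
= Σ_{i<j} [Aᵢ, Aⱼ]` for every word of one-parameter bond variables — the second-order term of (15)'s inner logarithm.
[cite: Balaban1985Averaging, (21) p.21, (15) p.19] -/
theorem iteratedDeriv_two_mlog_mul {α β α₁ β₁ : ℂ → 𝔸} {wa wb : 𝔸} (ha0 : α 0 = 1) (hb0 : β 0 = 1)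
    (hα : ∀ᶠ t in 𝓝 (0 : ℂ), HasDerivAt α (α₁ t) t) (hβ : ∀ᶠ t in 𝓝 (0 : ℂ), HasDerivAt β (β₁ t) t)
    (hα₁ : HasDerivAt α₁ wa 0) (hβ₁ : HasDerivAt β₁ wb 0) :
    iteratedDeriv 2 (fun t : ℂ => mlog (α t * β t)) 0
      = iteratedDeriv 2 (fun t : ℂ => mlog (α t)) 0 + iteratedDeriv 2 (fun t : ℂ => mlog (β t)) 0
        + (α₁ 0 * β₁ 0 - β₁ 0 * α₁ 0) := by
  have hprod : ∀ᶠ t in 𝓝 (0 : ℂ), HasDerivAt (fun u : ℂ => α u * β u) (α₁ t * β t + α t * β₁ t) t := by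
    filter_upwards [hα, hβ] with t hat hbt
    exact hat.fun_mul hbt
  have hprod₁ : HasDerivAt (fun t : ℂ => α₁ t * β t + α t * β₁ t)
      (wa * β 0 + α₁ 0 * β₁ 0 + (α₁ 0 * β₁ 0 + α 0 * wb)) 0 :=
    (hα₁.fun_mul hβ.self_of_nhds).fun_add (hα.self_of_nhds.fun_mul hβ₁)
  rw [iteratedDeriv_two_mlog_comp (γ := fun u : ℂ => α u * β u) (by simp [ha0, hb0]) hprod hprod₁,
    iteratedDeriv_two_mlog_comp ha0 hα hα₁, iteratedDeriv_two_mlog_comp hb0 hβ hβ₁, ha0, hb0]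
  noncomm_ring

/-! ## §5 Words of any length: `d²/dt²|₀ log ∏ᵢ e^{tAᵢ} = Σ_{i<j} [Aᵢ, Aⱼ]` -/

/-- Derivative data of the ordered product `t ↦ e^{tA₀} e^{tA₁} ⋯ e^{tA_{n−1}}` (as `List.ofFn`-product): a derivative at every
`t`, differentiable again at `0`, with velocity `Σᵢ Aᵢ` at `0` — by induction on the length (product rule). [folklore] -/
theorem exists_derivData_expProdList (n : ℕ) (A : Fin n → 𝔸) :
    ∃ γ₁ : ℂ → 𝔸, ∃ w : 𝔸,
      (∀ t : ℂ, HasDerivAt (fun u : ℂ => (List.ofFn fun i : Fin n => exp (u • A i)).prod) (γ₁ t) t)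
        ∧ HasDerivAt γ₁ w 0 ∧ γ₁ 0 = ∑ i, A i := by
  induction n with
  | zero =>
    refine ⟨fun _ => 0, 0, fun t => ?_, hasDerivAt_const (0 : ℂ) (0 : 𝔸), by simp⟩
    simpa using hasDerivAt_const t (1 : 𝔸)
  | succ n ih =>
    obtain ⟨β₁, wb, hβ, hβ₁, hβ0⟩ := ih (fun i => A i.succ)
    refine ⟨fun t => A 0 * exp (t • A 0) * (List.ofFn fun i : Fin n => exp (t • A i.succ)).prod
        + exp (t • A 0) * β₁ t, ?_, fun t => ?_, ?_, ?_⟩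
    · exact A 0 * A 0 * (List.ofFn fun i : Fin n => exp ((0 : ℂ) • A i.succ)).prod + A 0 * exp ((0 : ℂ) • A 0) * β₁ 0
        + (A 0 * exp ((0 : ℂ) • A 0) * β₁ 0 + exp ((0 : ℂ) • A 0) * wb)
    · have h := ((hasDerivAt_exp_smul_const' (A 0) t).fun_mul (hβ t))
      have e : (fun u : ℂ => (List.ofFn fun i : Fin (n + 1) => exp (u • A i)).prod)
          = fun u : ℂ => exp (u • A 0) * (List.ofFn fun i : Fin n => exp (u • A i.succ)).prod := by
        funext u; rw [List.ofFn_succ, List.prod_cons]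
      rw [e]
      simpa [mul_assoc] using h
    · have h1 : HasDerivAt (fun t : ℂ => A 0 * exp (t • A 0) * (List.ofFn fun i : Fin n => exp (t • A i.succ)).prod)
          (A 0 * A 0 * (List.ofFn fun i : Fin n => exp ((0 : ℂ) • A i.succ)).prod + A 0 * exp ((0 : ℂ) • A 0) * β₁ 0) 0 := by
        have := ((hasDerivAt_exp_smul_const' (A 0) (0 : ℂ)).const_mul (A 0)).fun_mul (hβ 0)
        simpa [mul_assoc] using this
      have h2 : HasDerivAt (fun t : ℂ => exp (t • A 0) * β₁ t)
          (A 0 * exp ((0 : ℂ) • A 0) * β₁ 0 + exp ((0 : ℂ) • A 0) * wb) 0 :=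
        (hasDerivAt_exp_smul_const' (A 0) (0 : ℂ)).fun_mul hβ₁
      exact h1.fun_add h2
    · simp [hβ0, Fin.sum_univ_succ]

/-- **WORDS OF ANY LENGTH — `d²/dt²|₀ log(e^{tA₀} e^{tA₁} ⋯ e^{tA_{n−1}}) = Σ_{i<j} [Aᵢ, Aⱼ]`**: the second-order term of the
printed `log` (21) along an ordered product of one-parameter bond variables is the sum of the pairwise commutators in the
word's order (induction on the length with the composition law `iteratedDeriv_two_mlog_mul`; each factor contributes `0`,
each ordered pair its commutator).  This is the inner logarithm of (15) for a GENERAL (non-commuting) field along a one-parameter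
slot direction: zero iff the pairwise commutators cancel — gen 8's abelian sector is the case where each vanishes.
[cite: Balaban1985Averaging, (21) p.21, (15) p.19] -/
theorem iteratedDeriv_two_mlog_expProdList_zero (n : ℕ) (A : Fin n → 𝔸) :
    iteratedDeriv 2 (fun t : ℂ => mlog ((List.ofFn fun i : Fin n => exp (t • A i)).prod)) 0
      = ∑ i : Fin n, ∑ j : Fin n, if i < j then A i * A j - A j * A i else 0 := by
  induction n with
  | zero =>
    have e : (fun t : ℂ => mlog ((List.ofFn fun i : Fin 0 => exp (t • A i)).prod)) = fun _ : ℂ => (0 : 𝔸) := by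
      funext t; simp
    rw [e, iteratedDeriv_eq_iterate]
    simp
  | succ n ih =>
    obtain ⟨β₁, wb, hβ, hβ₁, hβ0⟩ := exists_derivData_expProdList n (fun i => A i.succ)
    have e : (fun t : ℂ => mlog ((List.ofFn fun i : Fin (n + 1) => exp (t • A i)).prod))
        = fun t : ℂ => mlog (exp (t • A 0) * (List.ofFn fun i : Fin n => exp (t • A i.succ)).prod) := by
      funext t; rw [List.ofFn_succ, List.prod_cons]
    have hα₁ : HasDerivAt (fun t : ℂ => A 0 * exp (t • A 0)) (A 0 * A 0) 0 := by
      simpa using (hasDerivAt_exp_smul_const' (A 0) (0 : ℂ)).const_mul (A 0)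
    rw [e, iteratedDeriv_two_mlog_mul (α := fun t : ℂ => exp (t • A 0)) (α₁ := fun t : ℂ => A 0 * exp (t • A 0))
      (by simp) (by simp) (Filter.Eventually.of_forall fun t => hasDerivAt_exp_smul_const' (A 0) t)
      (Filter.Eventually.of_forall hβ) hα₁ hβ₁, iteratedDeriv_two_mlog_exp_smul_zero, ih (fun i => A i.succ), hβ0]
    simp only [zero_smul, exp_zero, mul_one, zero_add]
    rw [Fin.sum_univ_succ]
    simp only [Fin.sum_univ_succ (f := fun j => if (0 : Fin (n + 1)) < j then A 0 * A j - A j * A 0 else 0),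
      lt_self_iff_false, if_false, Fin.succ_pos, if_true, zero_add]
    have hinner : ∀ i : Fin n, (∑ j : Fin (n + 1), if i.succ < j then A i.succ * A j - A j * A i.succ else 0)
        = ∑ j : Fin n, if i < j then A i.succ * A j.succ - A j.succ * A i.succ else 0 := by
      intro i
      rw [Fin.sum_univ_succ]
      simp only [Fin.not_lt_zero, if_false, zero_add, Fin.succ_lt_succ_iff]
    simp only [hinner, Finset.mul_sum, Finset.sum_mul, ← Finset.sum_sub_distrib]
    abel

/-- The same for an arbitrary LIST of exponents (a word given as `l : List 𝔸`, product `∏ e^{t·l[i]}` in the list's order):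
`d²/dt²|₀ log((l.map (e^{t·})).prod) = Σ_{i<j} [l[i], l[j]]` — `iteratedDeriv_two_mlog_expProdList_zero` through
`List.ofFn (i ↦ f l[i]) = l.map f` (Mathlib `List.ofFn_getElem_eq_map`).  The form a consumer holding Bałaban's word
`Γ_{c,x} ∪ (−c)` as a list of (signed) bond exponents applies directly. [cite: Balaban1985Averaging, (21) p.21, (15) p.19] -/
theorem iteratedDeriv_two_mlog_expList_zero (l : List 𝔸) :
    iteratedDeriv 2 (fun t : ℂ => mlog ((l.map fun X => exp (t • X)).prod)) 0
      = ∑ i : Fin l.length, ∑ j : Fin l.length, if i < j then l[i] * l[j] - l[j] * l[i] else 0 := by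
  have e : (fun t : ℂ => mlog ((l.map fun X => exp (t • X)).prod))
      = fun t : ℂ => mlog ((List.ofFn fun i : Fin l.length => exp (t • l[(i : ℕ)])).prod) := by
    funext t
    rw [List.ofFn_getElem_eq_map l (fun X => exp (t • X))]
  rw [e]
  simp only [Fin.getElem_fin]
  exact iteratedDeriv_two_mlog_expProdList_zero l.length (fun i => l[(i : ℕ)])

/-! ## §6 The outer structure of (15): `log( exp(P(t)) · e^{tC} )` with `P(0) = 0` -/

/-- **`D² exp(0)(h, h) = h²`**: the second Fréchet derivative of the exponential at `0` on the diagonal (the `n = 2` term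
`h²/2!` of the exponential series times `2!`; Mathlib `NormedSpace.exp_hasFPowerSeriesOnBall`). [folklore] -/
theorem fderiv_fderiv_exp_zero_apply_self (h : 𝔸) :
    fderiv ℂ (fderiv ℂ (exp : 𝔸 → 𝔸)) 0 h h = h * h := by
  have h2 := (NormedSpace.exp_hasFPowerSeriesOnBall (𝕂 := ℂ) (𝔸 := 𝔸)).factorial_smul h 2
  rw [← iteratedFDeriv_two_apply (exp : 𝔸 → 𝔸) 0 (fun _ => h), ← h2, NormedSpace.expSeries_apply_eq,
    Nat.factorial_two, two_nsmul, ← add_smul, pow_two]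
  norm_num

/-- **THE OUTER STEP OF (15), GENERAL SECOND FACTOR** ([folklore]): for a curve `P` with `P(0) = 0`, derivative `P₁` near `0`,
`P₁′(0) = w`, and a curve `β` through `1` with derivative `β₁` near `0`, `β₁′(0) = w_b`:
`d²/dt²|₀ log( e^{P(t)} β(t) ) = w + d²/dt²|₀ log β + [P₁(0), β₁(0)]` — the composition law with `α = exp ∘ P`, whose
`log`-curvature is `w` (`D²exp(0)(v,v) + Dexp(0)(w) − v²`).  The SHAPE of (15)∕(42): `Ū_c(U) = exp[P]·U(c)` with `P` the
`L^{−d}`-average of the loop logarithms and `U(c)` the transport along the straight `L`-bond (itself a word).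
[cite: Balaban1985Averaging, (15) p.19, (21) p.21, (42) p.23] -/
theorem iteratedDeriv_two_mlog_exp_mul {P P₁ β β₁ : ℂ → 𝔸} {w wb : 𝔸} (h0 : P 0 = 0)
    (hP : ∀ᶠ t in 𝓝 (0 : ℂ), HasDerivAt P (P₁ t) t) (hP₁ : HasDerivAt P₁ w 0) (hb0 : β 0 = 1)
    (hβ : ∀ᶠ t in 𝓝 (0 : ℂ), HasDerivAt β (β₁ t) t) (hβ₁ : HasDerivAt β₁ wb 0) :
    iteratedDeriv 2 (fun t : ℂ => mlog (exp (P t) * β t)) 0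
      = w + iteratedDeriv 2 (fun t : ℂ => mlog (β t)) 0 + (P₁ 0 * β₁ 0 - β₁ 0 * P₁ 0) := by
  -- `α = exp ∘ P`: derivative `D exp(P t)(P₁ t)` near `0` (the exponential is analytic everywhere)
  have hα : ∀ᶠ t in 𝓝 (0 : ℂ), HasDerivAt (fun u : ℂ => exp (P u))
      (fderiv ℂ (exp : 𝔸 → 𝔸) (P t) (P₁ t)) t := by
    filter_upwards [hP] with t ht
    have h := ((NormedSpace.exp_analytic (𝕂 := ℂ) (P t)).differentiableAt.hasFDerivAt).comp_hasDerivAt t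
      (f := P) ht
    simpa [Function.comp_def] using h
  -- its derivative at `0`: `D²exp(P 0)(P₁ 0, P₁ 0) + D exp(P 0)(w)`
  have hC2 : ContDiffAt ℂ 2 (exp : 𝔸 → 𝔸) (P 0) := (NormedSpace.exp_analytic (𝕂 := ℂ) (P 0)).contDiffAt
  have hD : HasFDerivAt (fderiv ℂ (exp : 𝔸 → 𝔸)) (fderiv ℂ (fderiv ℂ (exp : 𝔸 → 𝔸)) (P 0)) (P 0) :=
    ((hC2.fderiv_right (m := 1) (by norm_num)).differentiableAt (by norm_num)).hasFDerivAt
  have hc : HasDerivAt (fun t : ℂ => fderiv ℂ (exp : 𝔸 → 𝔸) (P t))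
      (fderiv ℂ (fderiv ℂ (exp : 𝔸 → 𝔸)) (P 0) (P₁ 0)) 0 := by
    have := hD.comp_hasDerivAt (0 : ℂ) hP.self_of_nhds
    simpa [Function.comp_def] using this
  have hα₁ : HasDerivAt (fun t : ℂ => fderiv ℂ (exp : 𝔸 → 𝔸) (P t) (P₁ t))
      (fderiv ℂ (fderiv ℂ (exp : 𝔸 → 𝔸)) (P 0) (P₁ 0) (P₁ 0) + fderiv ℂ (exp : 𝔸 → 𝔸) (P 0) w) 0 :=
    hc.clm_apply hP₁
  rw [h0, fderiv_fderiv_exp_zero_apply_self, (hasFDerivAt_exp_zero (𝕂 := ℂ)).fderiv,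
    one_apply_eq_self] at hα₁
  rw [iteratedDeriv_two_mlog_mul (α := fun u : ℂ => exp (P u)) (α₁ := fun t : ℂ => fderiv ℂ (exp : 𝔸 → 𝔸) (P t) (P₁ t))
      (by simp [h0]) hb0 hα hβ hα₁ hβ₁,
    iteratedDeriv_two_mlog_comp (γ := fun u : ℂ => exp (P u)) (by simp [h0]) hα hα₁]
  simp only [h0, (hasFDerivAt_exp_zero (𝕂 := ℂ)).fderiv, one_apply_eq_self]
  abel

/-- **THE OUTER STEP OF (15)** ([folklore]): for a curve `P` with `P(0) = 0`, derivative `P₁` near `0` and `P₁′(0) = w`, and any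
`C`, `d²/dt²|₀ log( e^{P(t)} e^{tC} ) = w + [P₁(0), C]` — the composition law with `α = exp ∘ P` (whose `log`-curvature is
`P″(0) = w`: `D²exp(0)(v,v) + Dexp(0)(w) − v² = w`) and `β = e^{tC}` (no `log`-curvature).  This is the SHAPE of Bałaban's
(15)∕(42): `Ū_c(e^{tA}) = exp[P(t)]·e^{tA(c)}` with `P(t) = L^{−d} Σ_x log(e^{tA}(Γ_{c,x}) e^{−tA(c)})`, so
`d²/dt²|₀ log Ū_c(e^{tA}) = P″(0) + [P′(0), A(c)]`, and `P″(0)` is `L^{−d} Σ_x` of the ordered pairwise commutator sums of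
`iteratedDeriv_two_mlog_expProdList_zero` — every term a commutator. [cite: Balaban1985Averaging, (15) p.19, (21) p.21, (42) p.23] -/
theorem iteratedDeriv_two_mlog_exp_mul_exp_smul {P P₁ : ℂ → 𝔸} {w : 𝔸} (C : 𝔸) (h0 : P 0 = 0)
    (hP : ∀ᶠ t in 𝓝 (0 : ℂ), HasDerivAt P (P₁ t) t) (hP₁ : HasDerivAt P₁ w 0) :
    iteratedDeriv 2 (fun t : ℂ => mlog (exp (P t) * exp (t • C))) 0 = w + (P₁ 0 * C - C * P₁ 0) := by
  have hβ₁ : HasDerivAt (fun t : ℂ => C * exp (t • C)) (C * C) 0 := by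
    simpa using (hasDerivAt_exp_smul_const' C (0 : ℂ)).const_mul C
  rw [iteratedDeriv_two_mlog_exp_mul (β := fun t : ℂ => exp (t • C)) (β₁ := fun t : ℂ => C * exp (t • C)) h0 hP hP₁
      (by simp) (Filter.Eventually.of_forall fun t => hasDerivAt_exp_smul_const' C t) hβ₁,
    iteratedDeriv_two_mlog_exp_smul_zero]
  simp

end Summit.QuantumFields.BalabanUV.T4Continuum.NE1p.B7AveragingCommutator

end
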